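import Summits.RiemannHypothesis.RiemannHypothesis.Theorems.PlantedScrewBlindness

/-!
# W-06 cycle 7 «DETECTION COST ATLAS», cell C4⁷ rev 2 §7 — the SHARP entry bound of the screw blindness law (rh-idea-6 g15)

(CA116) lane slot (4): §7 (l.380–503) of `pub/ideators/rh-idea-6/g15/c47/PlantedScrewBlind-rh-idea-6-g15-rev2.lean`
sha16 cf841c9802ce9c85 · 506, VERBATIM, re-pointed by ONE import onto the landed §1–§6
(`Theorems/PlantedScrewBlindness.lean`) and the defs of record (`Theorems/PlantedPair.lean`); same namespace
`RhIdea6.G15.C47`; credit rh-idea-6 g15.  Sharp entry bound `|Q(t; δ, γ)| ≤ 2·(e^{δ|t|} + 3)/(δ² + γ²)`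
(decaying pair costs `2`), hence `|D_{n+1} i j| ≤ 6·((n+1)^δ + 3)/(δ² + γ²)` and the sharp corners
`γ ≥ 17000 / 5850 / 2440` at `M ≤ 512 / 256 / 128` (`0 ≤ δ ≤ 1/2`; sharp thresholds `16942 / 5797 / 2421.3`).
READING (TEST 0): the planted object is NOT `ζ`; nothing here bears on the truth of RH.
-/

noncomputable section


namespace RhIdea6.G15.C47

open Matrix
open Literature.NumberTheory.LFunctions
open RhIdea2G21.W06C6
open Summit.RiemannHypothesis.RiemannHypothesis.Theorems.IntegerScrew



/-! ### §7  (rev 2) The SHARP entry bound — the decaying pair costs `2`, not `e^{δ|t|} + 1`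

`|Q(t; δ, γ)| ≤ 2·(e^{δ|t|} + 3)/(δ² + γ²)` (growing pair `e^{δ|t|} + 1`, decaying pair `e^{−δ|t|} + 1 ≤ 2`), hence
`|D_{n+1} i j| ≤ 6·((n+1)^δ + 3)/(δ² + γ²)` — the shape of rh-idea-3's C3⁷ `stub_defectEntryBound` («entries ≤ 6((n+2)^δ+3)/γ²»,
Sketch v2 941c4ea6345fdba6), which it implies as soon as their `quadScrew γ δ` is rh-idea-2's `pairDefect δ γ` — and the
sharper corners `γ ≥ 17000 / 5850 / 2440` at `M ≤ 512 / 256 / 128` (sharp thresholds of this bound `16942 / 5797 / 2421.3` at `δ = 1/2`). -/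

/-- `|Q(t; δ, γ)| ≤ 2·(e^{δ|t|} + 3)/(δ² + γ²)` for `δ ≥ 0`, `γ ≠ 0`. -/
theorem abs_pairDefect_le_sharp {δ γ : ℝ} (hδ : 0 ≤ δ) (hγ : γ ≠ 0) (t : ℝ) :
    |pairDefect δ γ t| ≤ 2 * ((Real.exp (δ * |t|) + 3) / (δ ^ 2 + γ ^ 2)) := by
  have h1 := abs_re_increment_le δ γ t hγ
  have h2 := abs_re_increment_le (-δ) γ t hγ
  rw [neg_sq] at h2
  have hd : 0 < δ ^ 2 + γ ^ 2 := by positivity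
  have h3 : Real.exp (-δ * |t|) ≤ 1 :=
    Real.exp_le_one_iff.mpr (by rw [neg_mul]; linarith [mul_nonneg hδ (abs_nonneg t)])
  have h4 : (Real.exp (-δ * |t|) + 1) / (δ ^ 2 + γ ^ 2) ≤ 2 / (δ ^ 2 + γ ^ 2) :=
    div_le_div_of_nonneg_right (by linarith) hd.le
  have e : 2 * ((Real.exp (δ * |t|) + 3) / (δ ^ 2 + γ ^ 2)) =
      2 * ((Real.exp (δ * |t|) + 1) / (δ ^ 2 + γ ^ 2)) + 2 * (2 / (δ ^ 2 + γ ^ 2)) := by ring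
  unfold pairDefect
  refine (abs_add_le _ _).trans ?_
  rw [abs_mul, abs_mul, abs_two, e]
  linarith [h2.trans h4]

/-- Monotone envelope: `|t| ≤ L ⟹ |Q(t)| ≤ 2·(e^{δL} + 3)/(δ² + γ²)`. -/
theorem abs_pairDefect_le_sharp_of_abs_le {δ γ L t : ℝ} (hδ : 0 ≤ δ) (hγ : γ ≠ 0) (ht : |t| ≤ L) :
    |pairDefect δ γ t| ≤ 2 * ((Real.exp (δ * L) + 3) / (δ ^ 2 + γ ^ 2)) := by
  refine (abs_pairDefect_le_sharp hδ hγ t).trans ?_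
  have hd : 0 < δ ^ 2 + γ ^ 2 := by positivity
  have h1 : Real.exp (δ * |t|) ≤ Real.exp (δ * L) := Real.exp_le_exp.mpr (mul_le_mul_of_nonneg_left ht hδ)
  have h2 : (Real.exp (δ * |t|) + 3) / (δ ^ 2 + γ ^ 2) ≤ (Real.exp (δ * L) + 3) / (δ ^ 2 + γ ^ 2) :=
    div_le_div_of_nonneg_right (by linarith) hd.le
  linarith

/-- SHARP ENTRYWISE DEFECT BOUND: `|D_{n+1}(δ, γ) i j| ≤ 6·(e^{δ·log(n+1)} + 3)/(δ² + γ²) = 6·((n+1)^δ + 3)/(δ² + γ²)`. -/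
theorem abs_defectMatrix_le_sharp {δ γ : ℝ} (hδ : 0 ≤ δ) (hγ : γ ≠ 0) (n : ℕ) (i j : Fin n) :
    |defectMatrix δ γ n i j| ≤ 6 * ((Real.exp (δ * Real.log ((n : ℝ) + 1)) + 3) / (δ ^ 2 + γ ^ 2)) := by
  obtain ⟨hi0, hi⟩ := log_node_mem i
  obtain ⟨hj0, hj⟩ := log_node_mem j
  have h1 := abs_pairDefect_le_sharp_of_abs_le hδ hγ (t := Real.log (((i : ℕ) : ℝ) + 2))
    (L := Real.log ((n : ℝ) + 1)) (by rw [abs_of_nonneg hi0]; exact hi)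
  have h2 := abs_pairDefect_le_sharp_of_abs_le hδ hγ (t := Real.log (((j : ℕ) : ℝ) + 2))
    (L := Real.log ((n : ℝ) + 1)) (by rw [abs_of_nonneg hj0]; exact hj)
  have h3 := abs_pairDefect_le_sharp_of_abs_le hδ hγ
    (t := Real.log (((i : ℕ) : ℝ) + 2) - Real.log (((j : ℕ) : ℝ) + 2))
    (L := Real.log ((n : ℝ) + 1)) (abs_sub_le_iff.mpr ⟨by linarith, by linarith⟩)
  simp only [defectMatrix, defectKernel, Matrix.of_apply]
  have h4 := abs_add_le (pairDefect δ γ (Real.log (((i : ℕ) : ℝ) + 2)))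
    (pairDefect δ γ (Real.log (((j : ℕ) : ℝ) + 2)))
  have h5 := abs_sub (pairDefect δ γ (Real.log (((i : ℕ) : ℝ) + 2)) + pairDefect δ γ (Real.log (((j : ℕ) : ℝ) + 2)))
    (pairDefect δ γ (Real.log (((i : ℕ) : ℝ) + 2) - Real.log (((j : ℕ) : ℝ) + 2)))
  linarith

/-- **SCREW BLINDNESS LAW, sharp form**: margin `μ` for `S_{N+1}(ζ)`, `n ≤ N`, and
`n · 6·(e^{δ log(n+1)} + 3) < μ·(δ² + γ²) ⟹ S_{n+1}(planted δ, γ) ≻ 0`, i.e. blind for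
`γ ≥ b_S♯(n, δ; μ) = √(6 n ((n+1)^δ + 3)/μ − δ²)`. -/
theorem plantedScrewMatrix_posDef_of_margin_sharp {N n : ℕ} {μ δ γ : ℝ} (hn : n ≤ N)
    (hN : ∀ v : Fin N → ℝ, μ * (v ⬝ᵥ v) ≤ v ⬝ᵥ ((screwMatrix N).mulVec v))
    (hδ : 0 ≤ δ) (hγ : γ ≠ 0)
    (h : (n : ℝ) * (6 * ((Real.exp (δ * Real.log ((n : ℝ) + 1)) + 3) / (δ ^ 2 + γ ^ 2))) < μ) :
    (plantedScrewMatrix δ γ n).PosDef := by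
  have hH := plantedScrewMatrix_isHermitian δ γ n
  rw [plantedScrewMatrix_eq] at hH ⊢
  exact posDef_add_of_quadForm_ge hH (screwMatrix_quadForm_ge_of_le hn hN) (by positivity)
    (abs_defectMatrix_le_sharp hδ hγ n) h

/-- Sharp law at the tree margin `μ₅₁₂` (`M ≤ 512`). -/
theorem plantedScrewMatrix_posDef_of_bound_511_sharp {n : ℕ} {δ γ : ℝ} (hn : n ≤ 511) (hδ : 0 ≤ δ) (hγ : γ ≠ 0)
    (h : (n : ℝ) * (6 * ((Real.exp (δ * Real.log ((n : ℝ) + 1)) + 3) / (δ ^ 2 + γ ^ 2)))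
      < (154108636812 : ℝ) / 2 ^ 49) :
    (plantedScrewMatrix δ γ n).PosDef :=
  plantedScrewMatrix_posDef_of_margin_sharp hn screwMatrix_quadForm_ge_511 hδ hγ h

/-- **EXPLICIT CORNER, sharp generic**: `N·6·(B + 3) < μ·g₀²` with `(n+1)^δ ≤ B`, `0 < g₀ ≤ γ`. -/
theorem plantedScrewMatrix_posDef_of_corner_sharp {N n : ℕ} {μ δ γ B g₀ : ℝ} (hn : n ≤ N)
    (hN : ∀ v : Fin N → ℝ, μ * (v ⬝ᵥ v) ≤ v ⬝ᵥ ((screwMatrix N).mulVec v)) (hμ : 0 ≤ μ)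
    (hδ : 0 ≤ δ) (hE : Real.exp (δ * Real.log ((n : ℝ) + 1)) ≤ B) (hg₀ : 0 < g₀) (hγ : g₀ ≤ γ)
    (hnum : (N : ℝ) * (6 * (B + 3)) < μ * (g₀ * g₀)) :
    (plantedScrewMatrix δ γ n).PosDef := by
  have hγ0 : γ ≠ 0 := (hg₀.trans_le hγ).ne'
  refine plantedScrewMatrix_posDef_of_margin_sharp hn hN hδ hγ0 ?_
  have hEpos := Real.exp_pos (δ * Real.log ((n : ℝ) + 1))
  have hB3 : 0 ≤ B + 3 := by linarith
  have hd : 0 < δ ^ 2 + γ ^ 2 := by positivity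
  have hn' : (n : ℝ) ≤ N := by exact_mod_cast hn
  have hn0 : (0 : ℝ) ≤ n := Nat.cast_nonneg n
  have hγ2 : g₀ * g₀ ≤ γ * γ := mul_le_mul hγ hγ hg₀.le (hg₀.le.trans hγ)
  rw [show (n : ℝ) * (6 * ((Real.exp (δ * Real.log ((n : ℝ) + 1)) + 3) / (δ ^ 2 + γ ^ 2)))
      = (n : ℝ) * (6 * (Real.exp (δ * Real.log ((n : ℝ) + 1)) + 3)) / (δ ^ 2 + γ ^ 2) by ring,
    div_lt_iff₀ hd]
  nlinarith [mul_nonneg hn0 (sub_nonneg.mpr hE), mul_nonneg (sub_nonneg.mpr hn') hB3,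
    mul_le_mul_of_nonneg_left hγ2 hμ, mul_nonneg hμ (sq_nonneg δ)]

/-- **SHARP CORNER `M ≤ 512`**: `0 ≤ δ ≤ 1/2`, `γ ≥ 17000` (`511·6·(22.628 + 3) = 78575.4 < μ₅₁₂·17000² = 79114`;
sharp threshold of this bound `16942…`; rh-idea-3's `Γ₅₁₁(0.49) = 16490` is the same computation with `513^{0.49}`). -/
theorem plantedScrewMatrix_posDef_of_le_511_sharp {n : ℕ} {δ γ : ℝ} (hn : n ≤ 511) (hδ : 0 ≤ δ) (hδ' : δ ≤ 1 / 2)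
    (hγ : 17000 ≤ γ) : (plantedScrewMatrix δ γ n).PosDef :=
  plantedScrewMatrix_posDef_of_corner_sharp hn screwMatrix_quadForm_ge_511 (by norm_num) hδ
    (exp_mul_log_le (K := 512) (B := 22628 / 1000) (by omega) hδ' (by norm_num) (by norm_num))
    (by norm_num) hγ (by norm_num)

/-- **SHARP CORNER `M ≤ 256`**: `0 ≤ δ ≤ 1/2`, `γ ≥ 5850` (`255·6·19 = 29070 < μ₂₅₆·5850² = 29603`; sharp `5797…`). -/
theorem plantedScrewMatrix_posDef_of_le_255_sharp {n : ℕ} {δ γ : ℝ} (hn : n ≤ 255) (hδ : 0 ≤ δ) (hδ' : δ ≤ 1 / 2)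
    (hγ : 5850 ≤ γ) : (plantedScrewMatrix δ γ n).PosDef :=
  plantedScrewMatrix_posDef_of_corner_sharp hn screwMatrix_quadForm_ge_255 (by norm_num) hδ
    (exp_mul_log_le (K := 256) (B := 16) (by omega) hδ' (by norm_num) (by norm_num))
    (by norm_num) hγ (by norm_num)

/-- **SHARP CORNER `M ≤ 128`**: `0 ≤ δ ≤ 1/2`, `γ ≥ 2440` (`127·6·14.314 = 10907.3 < μ₁₂₈·2440² = 11076.6`; sharp `2421.3…`). -/
theorem plantedScrewMatrix_posDef_of_le_127_sharp {n : ℕ} {δ γ : ℝ} (hn : n ≤ 127) (hδ : 0 ≤ δ) (hδ' : δ ≤ 1 / 2)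
    (hγ : 2440 ≤ γ) : (plantedScrewMatrix δ γ n).PosDef :=
  plantedScrewMatrix_posDef_of_corner_sharp hn screwMatrix_quadForm_ge_127 (by norm_num) hδ
    (exp_mul_log_le (K := 128) (B := 11314 / 1000) (by omega) hδ' (by norm_num) (by norm_num))
    (by norm_num) hγ (by norm_num)

/-- «NOT seen by order `M ≤ 512`» for `γ ≥ 17000`, `0 ≤ δ ≤ 1/2`. -/
theorem not_screwSees_of_le_512_sharp {δ γ : ℝ} (hδ : 0 ≤ δ) (hδ' : δ ≤ 1 / 2) (hγ : 17000 ≤ γ) {M : ℕ}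
    (hM : M ≤ 512) : ¬ ∃ n : ℕ, n + 1 ≤ M ∧ ¬ (plantedScrewMatrix δ γ n).PosSemidef := by
  rintro ⟨n, hnM, hnot⟩
  exact hnot (plantedScrewMatrix_posDef_of_le_511_sharp (by omega) hδ hδ' hγ).posSemidef

end RhIdea6.G15.C47

end
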